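import Summits.QuantumFields.BalabanUV.Beta.CombHId2Torus
import Summits.QuantumFields.BalabanUV.Beta.CombHId2Periodised

/-!
# `BalabanUV.Beta.CombHId2TorusWords` — binder row D1 (OWNER an2), (J-a) dictionary, (C2) at ORDER 2, PART THREE (letters, 2b): **THE RESPONSE WORD, `K3OfK` AND
# `e4OfKW` OVER THE PERIODISED TABLES, READ ON THE TORUS** — `perF M (K3OfK K N S^per Mt^per W b b′) = Â·D̂_b·Â·D̂_{b′}·Â + Â·D̂_{b′}·Â·D̂_b·Â − Â·Ŵ_{bb′}·Â`

WHY.  `CombHId2Periodised.dper_tsum_e4OfKW_translate` delivers the door's copy-summed, periodised second bond derivative of the value function as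
`e4OfKW N K S^per Mt^per W^{per,cs} b b′ = mmRead N (K3OfK …)`, `K3OfK = −(K·dM_b·K2_{b′}) − (K·dM_{b′}·K2_b) − K·W_{bb′}·K`, `K2_{b′} = −K·dM_{b′}·K`.  On the torus every
factor is a matrix (`Â := perF M K`, `D̂_b := perF M (dM K N S^per Mt^per b)`, `Ŵ := perF M (W b b′)`) and the products are matrix products (gan24-p3's `perF_comp`): this
file turns the three words into the torus polynomial the door's `hId₂` reads (leaf-05 `FP/CoarseJetOrderTwoGradedComb` — all `Γ̂ ∕ Θ ∕ Ŝ`-joined bilinear monomials in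
`(H₁, Q₁₁)` come from the two quintic products, `D̂_b = Σ Θ-col•H₁-tables + Σ Ŝ-col•Q₁₁-tables` by C2b ∕ `CombHId2Torus` §3–§4), and reads the response word
`dM (K2OfK^per b′) N S^per Mt^per b` of `W2OfK` (PART TWO-c `dper_tsum_word₄`) as the `−(Â·D̂_{b′}·Â)`-column-weighted sum of the periodised tables' torus matrices.
WHAT ([folklore]; 0 `def`, 0 cited fact, 0 `def … : Prop`, 0 sorry; `M = N·M′`, C3a's sockets on `K, S, Mt`; `W b b′` fine-period invariant and decaying AT THE BOND PAIR READ — at the record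
`W^{per,cs}` is `dper` of a far-small copy sum, `CombHId2Periodised`): §1 `K2OfK_dper_translate_inv`, `exists_decays_K2OfK_dper` (the derivative of the inverse over the
periodised tables is invariant and decays); §2 **`perF_dM_K2OfK_dper_apply`** (`perF M (dM (K2OfK K N S^per Mt^per ν y′) N S^per Mt^per μ y) P Q =
Σ_{u∈pbox M,κ} (−(Â·D̂_{ν y′}·Â))((u, inl κ),(wrapPt M (N•y), inr μ)) · perF M (S^per κ u) P Q + Σ_{w∈pbox M′,ρ} (−(Â·D̂_{ν y′}·Â))((wrapPt M (N•w), inr ρ),(wrapPt M (N•y), inr μ)) ·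
perF M (Mt^per ρ w) P Q` — `CombHId2Torus.perF_dM_dper` at the kernel `K2OfK^per`, C2b `perF_vertexOfK_dper_apply`, `CombHId2Torus.perF_vertexOfM_dper_apply`, the weights
read by C2a `perZ_coarse_col_eq_perF` ∕ `CombHId2Torus.perZ_coarse_coarse_eq_perF` + §2 `perF_K2OfK_dper`); §3 `decays_sub_min`, `K3OfK_eq_sub`, `K3OfK_dper_translate_inv`,
`exists_decays_K3OfK_dper`, **`perF_K3OfK_dper`** (the displayed polynomial); §4 **`perF_e4OfKW_dper_inl_inl`** (`perF M′ (e4OfKW N K S^per Mt^per W b b′) ((y₁, inl m₁),(y₂, inl m₂))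
= (Â·D̂_b·Â·D̂_{b′}·Â + Â·D̂_{b′}·Â·D̂_b·Â − Â·Ŵ·Â)((wrapPt M (N•y₁), inr m₁),(wrapPt M (N•y₂), inr m₂))` — C2a `perF_mmRead_inl_inl_eq_perF`).
NOT HERE: the record's families substituted (letters 2c), the torus algebra against leaf-05 §1 (leaf-05's junction cert); nothing of Bałaban's asserted; NOT D1,
NEVER «G-an2-4 closed», NOT BetaPertH, NOT continuum, NOT Clay.

HONEST DEPENDENCY (page 1, mandatory): continuum YM on T⁴ ⇐ BetaPertH ∧ nine spine estimates (0/9 proved); BetaPertH ⇐ (D1) ∧ (D4) ∧ CAP+tail;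
G-an2-4 gates asym, D1 and NE2/3/4.  HONEST FRAMING (cell contract, verbatim): «discharging `BetaPertH` makes Bałaban's UV stability UNCONDITIONAL —
a real constructive-QFT result; it is NOT the continuum limit and NOT the Clay problem.»  ABSOLUTE RULE (cell charter, verbatim): «No internally-minted
statement may enter as a cited fact. Every hypothesis is either kernel-proved in this package or a verbatim quotation of a PUBLISHED theorem with page
reference. The manuscript(s) under audit are NOT citable for their own disputed steps — they are the thing under adjudication; programme-internal
(2001/route/tribunal) claims are never citable.»  Row D1 OWNER an2 (b2b-balaban-beta-an2) gen 45, 2026-08-23; over `CombHId2Torus`, C2a, C2b, C3d-ii and `FP.KernelPeriodisationFib` BY NAME.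
-/

noncomputable section

open scoped BigOperators Matrix

namespace Summit.QuantumFields.BalabanUV.Beta.CombHId2TorusWords

open Literature.MathematicalPhysics.QuantumFieldTheory.Balaban1983to89
open Literature.MathematicalPhysics.QuantumFieldTheory.Balaban1983to89.Beta
open B4TorusKernel.MultiPeriod (translate translate_apply)
open ExpKernelCalculus (MKer Decays BiLoc VertexFamily comp)
open AffineAveraging (Site)
open OneStepResolventKernel (Fib decays_mono)
open SecondOrderResponse (vertexOfM dM K2OfK)
open BalabanStepJetsSucc (mmRead)
open BalabanStepW2 (K3OfK)
open Summit.QuantumFields.BalabanUV.Beta.SpineRooted (e4OfKW)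
open Summit.QuantumFields.BalabanUV.Beta.FP.KernelPeriodisationFib (Idx perF perZ perF_apply perZ_apply perF_comp perF_smul perF_sub)
open Summit.QuantumFields.BalabanUV.Beta.FP.KernelPeriodisationFibLoc (dper dper_apply dper_translate)
open Summit.QuantumFields.BalabanUV.Beta.FP.TorusGaugeCovariancePairing (wrapPt wrapPt_coe)
open Summit.QuantumFields.BalabanUV.Beta.CombHId1Letters (perZ_coarse_col_eq_perF perF_mmRead_inl_inl_eq_perF)
open Summit.QuantumFields.BalabanUV.Beta.CombHId1Sandwich (exists_decays_comp comp_translate_inv perF_vertexOfK_dper_apply)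
open B12Sec2to5 (l1 l1_nonneg)
open B6Lemma24Torus (pbox)
open OneStepKernelFamily (vertexOfK)
open Summit.QuantumFields.BalabanUV.Beta.CombHId2Torus (dM_dper_translate_inv exists_decays_dM_dper perF_K2OfK_dper perF_dM_dper perF_vertexOfM_dper_apply
  perZ_coarse_coarse_eq_perF)

variable {d : ℕ} (M : Fin (d + 1) → ℕ) [∀ μ, NeZero (M μ)] {N : ℕ} [NeZero N] {M' : Fin (d + 1) → ℕ} {K : MKer (d + 1) (Fib d)}
  {CK δK CS δS CM δM : ℝ} {S Mt : Fin (d + 1) → Site (d + 1) → MKer (d + 1) (Fib d)}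

/-! ## §1 The derivative of the inverse over the periodised tables: invariant and decaying -/

/-- [folklore] `K2OfK K N S^per Mt^per b′` is invariant under the fine period lattice (`−K·dM^per_{b′}·K`: C2b `comp_translate_inv` twice on
`CombHId2Torus.dM_dper_translate_inv`). -/
theorem K2OfK_dper_translate_inv (hM : ∀ i, M i = N * M' i)
    (hKinv : ∀ (m x z : Site (d + 1)) (a b : Fib d), K (translate M x m) (translate M z m) a b = K x z a b)
    (hK : Decays K CK δK) (hδK : 0 < δK)
    (hSt : ∀ (κ : Fin (d + 1)) (u m x z : Site (d + 1)) (a b : Fib d), S κ (translate M u m) (translate M x m) (translate M z m) a b = S κ u x z a b)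
    (hS : ∀ κ u, BiLoc (S κ u) u u CS δS) (hδS : 0 < δS)
    (hMt : ∀ (ρ : Fin (d + 1)) (w m x z : Site (d + 1)) (a b : Fib d),
      Mt ρ (translate M' w m) (translate M x m) (translate M z m) a b = Mt ρ w x z a b)
    (hMloc : VertexFamily Mt N CM δM) (hδM : 0 < δM) (ν : Fin (d + 1)) (y' : Site (d + 1)) (m x z : Site (d + 1)) (a b : Fib d) :
    K2OfK K N (fun κ u => dper M (S κ u)) (fun ρ w => dper M (Mt ρ w)) ν y' (translate M x m) (translate M z m) a b
      = K2OfK K N (fun κ u => dper M (S κ u)) (fun ρ w => dper M (Mt ρ w)) ν y' x z a b := by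
  have hV := dM_dper_translate_inv M hM hKinv hK hδK hSt hS hδS hMt hMloc hδM ν y'
  show -(comp (comp K _) K (translate M x m) (translate M z m) a b) = -(comp (comp K _) K x z a b)
  rw [comp_translate_inv M (comp_translate_inv M hKinv hV) hKinv]

/-- [folklore] … and decays (C2b `exists_decays_comp` twice on `CombHId2Torus.exists_decays_dM_dper`). -/
theorem exists_decays_K2OfK_dper (hM : ∀ i, M i = N * M' i)
    (hKinv : ∀ (m x z : Site (d + 1)) (a b : Fib d), K (translate M x m) (translate M z m) a b = K x z a b)
    (hK : Decays K CK δK) (hδK : 0 < δK)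
    (hSt : ∀ (κ : Fin (d + 1)) (u m x z : Site (d + 1)) (a b : Fib d), S κ (translate M u m) (translate M x m) (translate M z m) a b = S κ u x z a b)
    (hS : ∀ κ u, BiLoc (S κ u) u u CS δS) (hδS : 0 < δS)
    (hMt : ∀ (ρ : Fin (d + 1)) (w m x z : Site (d + 1)) (a b : Fib d),
      Mt ρ (translate M' w m) (translate M x m) (translate M z m) a b = Mt ρ w x z a b)
    (hMloc : VertexFamily Mt N CM δM) (hδM : 0 < δM) (ν : Fin (d + 1)) (y' : Site (d + 1)) :
    ∃ C δ : ℝ, 0 < δ ∧ 0 ≤ C ∧ Decays (K2OfK K N (fun κ u => dper M (S κ u)) (fun ρ w => dper M (Mt ρ w)) ν y') C δ := by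
  obtain ⟨CV, δV, hδV, -, hVd⟩ := exists_decays_dM_dper M hM hKinv hK hδK hSt hS hδS hMt hMloc hδM ν y'
  obtain ⟨C₁, δ₁, hδ₁, h₁⟩ := exists_decays_comp hK hδK hVd hδV
  obtain ⟨C₂, δ₂, hδ₂, h₂⟩ := exists_decays_comp h₁ hδ₁ hK hδK
  refine ⟨C₂, δ₂, hδ₂, h₂.nonneg (Sum.inl 0), fun x z a b => ?_⟩
  show |-(comp (comp K _) K x z a b)| ≤ _
  rw [abs_neg]
  exact h₂ x z a b

/-! ## §2 The response word of `W2OfK` on the torus -/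

/-- [folklore] **THE RESPONSE WORD ON THE TORUS** (`M = N·M′`; `Â := perF M K`, `D̂_{ν y′} := perF M (dM K N S^per Mt^per ν y′)`):
`perF M (dM (K2OfK K N S^per Mt^per ν y′) N S^per Mt^per μ y) P Q
 = Σ_{u ∈ pbox M} Σ_κ (−(Â·D̂_{ν y′}·Â))((u, inl κ), (wrapPt M (N•y), inr μ)) · perF M (dper M (S κ u)) P Q
 + Σ_{w ∈ pbox M′} Σ_ρ (−(Â·D̂_{ν y′}·Â))((wrapPt M (N•w), inr ρ), (wrapPt M (N•y), inr μ)) · perF M (dper M (Mt ρ w)) P Q`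
— the vertices of the FIXED periodised tables through the kernel `K2OfK^per_{ν y′}` (invariant, decaying: §1), read by `CombHId2Torus.perF_dM_dper` + C2b
`perF_vertexOfK_dper_apply` + `CombHId2Torus.perF_vertexOfM_dper_apply`; the weights are torus entries of `perF M (K2OfK^per) = −(Â·D̂·Â)` (`CombHId2Torus.perF_K2OfK_dper`).
This is where the door's `Γ̂ ∕ Θ ∕ Ŝ`-joined bilinear monomials in `(H₁, Q₁₁)` with one inner `Â·D̂·Â` come from. -/
theorem perF_dM_K2OfK_dper_apply [∀ μ, NeZero (M' μ)] (hM : ∀ i, M i = N * M' i)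
    (hKinv : ∀ (m x z : Site (d + 1)) (a b : Fib d), K (translate M x m) (translate M z m) a b = K x z a b)
    (hK : Decays K CK δK) (hδK : 0 < δK)
    (hSt : ∀ (κ : Fin (d + 1)) (u m x z : Site (d + 1)) (a b : Fib d), S κ (translate M u m) (translate M x m) (translate M z m) a b = S κ u x z a b)
    (hS : ∀ κ u, BiLoc (S κ u) u u CS δS) (hδS : 0 < δS)
    (hMt : ∀ (ρ : Fin (d + 1)) (w m x z : Site (d + 1)) (a b : Fib d),
      Mt ρ (translate M' w m) (translate M x m) (translate M z m) a b = Mt ρ w x z a b)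
    (hMloc : VertexFamily Mt N CM δM) (hδM : 0 < δM)
    (μ : Fin (d + 1)) (y : Site (d + 1)) (ν : Fin (d + 1)) (y' : Site (d + 1)) (P Q : Idx M (Fib d)) :
    perF M (dM (K2OfK K N (fun κ u => dper M (S κ u)) (fun ρ w => dper M (Mt ρ w)) ν y') N
        (fun κ u => dper M (S κ u)) (fun ρ w => dper M (Mt ρ w)) μ y) P Q
      = ∑ u : ↥(pbox M), ∑ κ : Fin (d + 1),
            (-(perF M K * perF M (dM K N (fun κ u => dper M (S κ u)) (fun ρ w => dper M (Mt ρ w)) ν y') * perF M K))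
                (u, Sum.inl κ) (wrapPt M ((N : ℤ) • y), Sum.inr μ) * perF M (dper M (S κ (u : Site (d + 1)))) P Q
        + ∑ w : ↥(pbox M'), ∑ ρ : Fin (d + 1),
            (-(perF M K * perF M (dM K N (fun κ u => dper M (S κ u)) (fun ρ w => dper M (Mt ρ w)) ν y') * perF M K))
                (wrapPt M ((N : ℤ) • (w : Site (d + 1))), Sum.inr ρ) (wrapPt M ((N : ℤ) • y), Sum.inr μ)
              * perF M (dper M (Mt ρ (w : Site (d + 1)))) P Q := by
  obtain ⟨C₂, δ₂, hδ₂, -, hK₂⟩ := exists_decays_K2OfK_dper M hM hKinv hK hδK hSt hS hδS hMt hMloc hδM ν y'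
  have hK₂inv := K2OfK_dper_translate_inv M hM hKinv hK hδK hSt hS hδS hMt hMloc hδM ν y'
  rw [← perF_K2OfK_dper M hM hKinv hK hδK hSt hS hδS hMt hMloc hδM ν y', perF_dM_dper M hM hK₂inv hK₂ hδ₂ hSt hS hδS hMt hMloc hδM μ y,
    Matrix.add_apply, perF_vertexOfK_dper_apply M hK₂inv hK₂ hδ₂ hSt hS hδS μ y P Q,
    perF_vertexOfM_dper_apply M hM hK₂inv hK₂ hδ₂ hMt hMloc hδM μ y P Q]
  simp only [perZ_coarse_col_eq_perF, perZ_coarse_coarse_eq_perF M hK₂inv]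

/-! ## §3 `K3OfK` over the periodised tables on the torus: the displayed polynomial -/

section K3

variable {W : Fin (d + 1) → Site (d + 1) → Fin (d + 1) → Site (d + 1) → MKer (d + 1) (Fib d)} {CW δW : ℝ}

omit [∀ μ, NeZero (M μ)] [NeZero N] in
/-- [folklore] the difference of two decaying kernels decays at the smaller rate (crude constant). -/
theorem decays_sub_min {A B : MKer (d + 1) (Fib d)} {CA α CB β : ℝ} (hA : Decays A CA α) (hB : Decays B CB β) :
    Decays (A - B) (CA + CB) (min α β) := by
  have hCA : 0 ≤ CA := hA.nonneg (Sum.inl 0)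
  have hCB : 0 ≤ CB := hB.nonneg (Sum.inl 0)
  have hA' := decays_mono hA hCA le_rfl (min_le_left α β)
  have hB' := decays_mono hB hCB le_rfl (min_le_right α β)
  intro x z a b
  rw [Pi.sub_apply, Pi.sub_apply, Pi.sub_apply, Pi.sub_apply, add_mul]
  exact (abs_sub _ _).trans (add_le_add (hA' x z a b) (hB' x z a b))

omit [∀ μ, NeZero (M μ)] [NeZero N] in
/-- [folklore] `K3OfK` as a combination of kernels: `K3OfK K N S′ Mt′ W′ b b′ = (−1)•(K·dM_b·K2_{b′}) − K·dM_{b′}·K2_b − K·W′_{bb′}·K` (`BalabanStepW2.K3OfK` unfolded). -/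
theorem K3OfK_eq_sub (S' Mt' : Fin (d + 1) → Site (d + 1) → MKer (d + 1) (Fib d))
    (W' : Fin (d + 1) → Site (d + 1) → Fin (d + 1) → Site (d + 1) → MKer (d + 1) (Fib d))
    (μ : Fin (d + 1)) (y : Site (d + 1)) (ν : Fin (d + 1)) (y' : Site (d + 1)) :
    K3OfK K N S' Mt' W' μ y ν y'
      = (-1 : ℝ) • comp (comp K (dM K N S' Mt' μ y)) (K2OfK K N S' Mt' ν y')
          - comp (comp K (dM K N S' Mt' ν y')) (K2OfK K N S' Mt' μ y) - comp (comp K (W' μ y ν y')) K := by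
  funext x z a b
  simp only [K3OfK, Pi.sub_apply, Pi.smul_apply, smul_eq_mul, neg_one_mul]

/-- [folklore] `K3OfK` over the periodised tables is invariant under the fine period lattice (for `W b b′` invariant). -/
theorem K3OfK_dper_translate_inv (hM : ∀ i, M i = N * M' i)
    (hKinv : ∀ (m x z : Site (d + 1)) (a b : Fib d), K (translate M x m) (translate M z m) a b = K x z a b)
    (hK : Decays K CK δK) (hδK : 0 < δK)
    (hSt : ∀ (κ : Fin (d + 1)) (u m x z : Site (d + 1)) (a b : Fib d), S κ (translate M u m) (translate M x m) (translate M z m) a b = S κ u x z a b)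
    (hS : ∀ κ u, BiLoc (S κ u) u u CS δS) (hδS : 0 < δS)
    (hMt : ∀ (ρ : Fin (d + 1)) (w m x z : Site (d + 1)) (a b : Fib d),
      Mt ρ (translate M' w m) (translate M x m) (translate M z m) a b = Mt ρ w x z a b)
    (hMloc : VertexFamily Mt N CM δM) (hδM : 0 < δM)
    (μ : Fin (d + 1)) (y : Site (d + 1)) (ν : Fin (d + 1)) (y' : Site (d + 1))
    (hWinv : ∀ (m x z : Site (d + 1)) (a b : Fib d), W μ y ν y' (translate M x m) (translate M z m) a b = W μ y ν y' x z a b)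
    (m x z : Site (d + 1)) (a b : Fib d) :
    K3OfK K N (fun κ u => dper M (S κ u)) (fun ρ w => dper M (Mt ρ w)) W μ y ν y' (translate M x m) (translate M z m) a b
      = K3OfK K N (fun κ u => dper M (S κ u)) (fun ρ w => dper M (Mt ρ w)) W μ y ν y' x z a b := by
  have hV := dM_dper_translate_inv M hM hKinv hK hδK hSt hS hδS hMt hMloc hδM μ y
  have hV' := dM_dper_translate_inv M hM hKinv hK hδK hSt hS hδS hMt hMloc hδM ν y'
  have hK₂ := K2OfK_dper_translate_inv M hM hKinv hK hδK hSt hS hδS hMt hMloc hδM μ y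
  have hK₂' := K2OfK_dper_translate_inv M hM hKinv hK hδK hSt hS hδS hMt hMloc hδM ν y'
  have h1 := comp_translate_inv M (comp_translate_inv M hKinv hV) hK₂' m x z a b
  have h2 := comp_translate_inv M (comp_translate_inv M hKinv hV') hK₂ m x z a b
  have h3 := comp_translate_inv M (comp_translate_inv M hKinv hWinv) hKinv m x z a b
  show -(comp (comp K _) _ (translate M x m) (translate M z m) a b) - comp (comp K _) _ (translate M x m) (translate M z m) a b
      - comp (comp K _) K (translate M x m) (translate M z m) a b = -(comp (comp K _) _ x z a b) - comp (comp K _) _ x z a b - comp (comp K _) K x z a b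
  rw [h1, h2, h3]

/-- [folklore] … and decays. -/
theorem exists_decays_K3OfK_dper (hM : ∀ i, M i = N * M' i)
    (hKinv : ∀ (m x z : Site (d + 1)) (a b : Fib d), K (translate M x m) (translate M z m) a b = K x z a b)
    (hK : Decays K CK δK) (hδK : 0 < δK)
    (hSt : ∀ (κ : Fin (d + 1)) (u m x z : Site (d + 1)) (a b : Fib d), S κ (translate M u m) (translate M x m) (translate M z m) a b = S κ u x z a b)
    (hS : ∀ κ u, BiLoc (S κ u) u u CS δS) (hδS : 0 < δS)
    (hMt : ∀ (ρ : Fin (d + 1)) (w m x z : Site (d + 1)) (a b : Fib d),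
      Mt ρ (translate M' w m) (translate M x m) (translate M z m) a b = Mt ρ w x z a b)
    (hMloc : VertexFamily Mt N CM δM) (hδM : 0 < δM)
    (μ : Fin (d + 1)) (y : Site (d + 1)) (ν : Fin (d + 1)) (y' : Site (d + 1)) (hWd : Decays (W μ y ν y') CW δW) (hδW : 0 < δW) :
    ∃ C δ : ℝ, 0 < δ ∧ 0 ≤ C ∧ Decays (K3OfK K N (fun κ u => dper M (S κ u)) (fun ρ w => dper M (Mt ρ w)) W μ y ν y') C δ := by
  obtain ⟨CV, δV, hδV, -, hVd⟩ := exists_decays_dM_dper M hM hKinv hK hδK hSt hS hδS hMt hMloc hδM μ y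
  obtain ⟨CV', δV', hδV', -, hV'd⟩ := exists_decays_dM_dper M hM hKinv hK hδK hSt hS hδS hMt hMloc hδM ν y'
  obtain ⟨C₂, δ₂, hδ₂, -, hK₂⟩ := exists_decays_K2OfK_dper M hM hKinv hK hδK hSt hS hδS hMt hMloc hδM μ y
  obtain ⟨C₂', δ₂', hδ₂', -, hK₂'⟩ := exists_decays_K2OfK_dper M hM hKinv hK hδK hSt hS hδS hMt hMloc hδM ν y'
  obtain ⟨CB, δB, hδB, hB⟩ := exists_decays_comp hK hδK hVd hδV
  obtain ⟨CB', δB', hδB', hB'⟩ := exists_decays_comp hK hδK hV'd hδV'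
  obtain ⟨C1, δ1, hδ1, h1⟩ := exists_decays_comp hB hδB hK₂' hδ₂'
  obtain ⟨C2, δ2, hδ2, h2⟩ := exists_decays_comp hB' hδB' hK₂ hδ₂
  obtain ⟨CKW, δKW, hδKW, hKW⟩ := exists_decays_comp hK hδK hWd hδW
  obtain ⟨C3, δ3, hδ3, h3⟩ := exists_decays_comp hKW hδKW hK hδK
  have h1s : Decays ((-1 : ℝ) • comp (comp K (dM K N (fun κ u => dper M (S κ u)) (fun ρ w => dper M (Mt ρ w)) μ y))
      (K2OfK K N (fun κ u => dper M (S κ u)) (fun ρ w => dper M (Mt ρ w)) ν y')) C1 δ1 := fun x z a b => by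
    rw [Pi.smul_apply, Pi.smul_apply, Pi.smul_apply, Pi.smul_apply, smul_eq_mul, neg_one_mul, abs_neg]; exact h1 x z a b
  have h12 := decays_sub_min h1s h2
  have h123 := decays_sub_min h12 h3
  refine ⟨_, _, lt_min (lt_min hδ1 hδ2) hδ3, h123.nonneg (Sum.inl 0), ?_⟩
  rw [K3OfK_eq_sub]
  exact h123

/-- [folklore] **`perF_K3OfK_dper` — `K3OfK` OVER THE PERIODISED TABLES ON THE TORUS IS THE DISPLAYED POLYNOMIAL**: with `Â := perF M K`,
`D̂_b := perF M (dM K N S^per Mt^per b)`, `Ŵ := perF M (W b b′)` (`W b b′` fine-period invariant and decaying),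
`perF M (K3OfK K N S^per Mt^per W b b′) = Â·D̂_b·Â·D̂_{b′}·Â + Â·D̂_{b′}·Â·D̂_b·Â − Â·Ŵ·Â`
(`perF_sub` ∕ `perF_smul` on the three words, gan24-p3's `perF_comp` on every product — right factors invariant: §1 —, `CombHId2Torus.perF_K2OfK_dper` for the inner
`K2 = −Â·D̂·Â`, then `noncomm_ring`). -/
theorem perF_K3OfK_dper (hM : ∀ i, M i = N * M' i)
    (hKinv : ∀ (m x z : Site (d + 1)) (a b : Fib d), K (translate M x m) (translate M z m) a b = K x z a b)
    (hK : Decays K CK δK) (hδK : 0 < δK)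
    (hSt : ∀ (κ : Fin (d + 1)) (u m x z : Site (d + 1)) (a b : Fib d), S κ (translate M u m) (translate M x m) (translate M z m) a b = S κ u x z a b)
    (hS : ∀ κ u, BiLoc (S κ u) u u CS δS) (hδS : 0 < δS)
    (hMt : ∀ (ρ : Fin (d + 1)) (w m x z : Site (d + 1)) (a b : Fib d),
      Mt ρ (translate M' w m) (translate M x m) (translate M z m) a b = Mt ρ w x z a b)
    (hMloc : VertexFamily Mt N CM δM) (hδM : 0 < δM)
    (μ : Fin (d + 1)) (y : Site (d + 1)) (ν : Fin (d + 1)) (y' : Site (d + 1))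
    (hWinv : ∀ (m x z : Site (d + 1)) (a b : Fib d), W μ y ν y' (translate M x m) (translate M z m) a b = W μ y ν y' x z a b)
    (hWd : Decays (W μ y ν y') CW δW) (hδW : 0 < δW) :
    perF M (K3OfK K N (fun κ u => dper M (S κ u)) (fun ρ w => dper M (Mt ρ w)) W μ y ν y')
      = perF M K * perF M (dM K N (fun κ u => dper M (S κ u)) (fun ρ w => dper M (Mt ρ w)) μ y) * perF M K
            * perF M (dM K N (fun κ u => dper M (S κ u)) (fun ρ w => dper M (Mt ρ w)) ν y') * perF M K
        + perF M K * perF M (dM K N (fun κ u => dper M (S κ u)) (fun ρ w => dper M (Mt ρ w)) ν y') * perF M K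
            * perF M (dM K N (fun κ u => dper M (S κ u)) (fun ρ w => dper M (Mt ρ w)) μ y) * perF M K
        - perF M K * perF M (W μ y ν y') * perF M K := by
  -- the letters: decay and invariance of every factor
  obtain ⟨CV, δV, hδV, -, hVd⟩ := exists_decays_dM_dper M hM hKinv hK hδK hSt hS hδS hMt hMloc hδM μ y
  obtain ⟨CV', δV', hδV', -, hV'd⟩ := exists_decays_dM_dper M hM hKinv hK hδK hSt hS hδS hMt hMloc hδM ν y'
  have hVinv := dM_dper_translate_inv M hM hKinv hK hδK hSt hS hδS hMt hMloc hδM μ y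
  have hV'inv := dM_dper_translate_inv M hM hKinv hK hδK hSt hS hδS hMt hMloc hδM ν y'
  obtain ⟨C₂, δ₂, hδ₂, -, hK₂⟩ := exists_decays_K2OfK_dper M hM hKinv hK hδK hSt hS hδS hMt hMloc hδM μ y
  obtain ⟨C₂', δ₂', hδ₂', -, hK₂'⟩ := exists_decays_K2OfK_dper M hM hKinv hK hδK hSt hS hδS hMt hMloc hδM ν y'
  have hK₂inv := K2OfK_dper_translate_inv M hM hKinv hK hδK hSt hS hδS hMt hMloc hδM μ y
  have hK₂'inv := K2OfK_dper_translate_inv M hM hKinv hK hδK hSt hS hδS hMt hMloc hδM ν y'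
  obtain ⟨CB, δB, hδB, hB⟩ := exists_decays_comp hK hδK hVd hδV
  obtain ⟨CB', δB', hδB', hB'⟩ := exists_decays_comp hK hδK hV'd hδV'
  obtain ⟨C1, δ1, hδ1, h1⟩ := exists_decays_comp hB hδB hK₂' hδ₂'
  obtain ⟨C2, δ2, hδ2, h2⟩ := exists_decays_comp hB' hδB' hK₂ hδ₂
  obtain ⟨CKW, δKW, hδKW, hKW⟩ := exists_decays_comp hK hδK hWd hδW
  obtain ⟨C3, δ3, hδ3, h3⟩ := exists_decays_comp hKW hδKW hK hδK
  have h1s : Decays ((-1 : ℝ) • comp (comp K (dM K N (fun κ u => dper M (S κ u)) (fun ρ w => dper M (Mt ρ w)) μ y))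
      (K2OfK K N (fun κ u => dper M (S κ u)) (fun ρ w => dper M (Mt ρ w)) ν y')) C1 δ1 := fun x z a b => by
    rw [Pi.smul_apply, Pi.smul_apply, Pi.smul_apply, Pi.smul_apply, smul_eq_mul, neg_one_mul, abs_neg]; exact h1 x z a b
  have h12 := decays_sub_min h1s h2
  -- the words, one `perF_comp` per product
  rw [K3OfK_eq_sub, perF_sub M h12 h3 (lt_min hδ1 hδ2) hδ3, perF_sub M h1s h2 hδ1 hδ2, perF_smul,
    perF_comp M hB hK₂' hδB hδ₂' hK₂'inv, perF_comp M hK hVd hδK hδV hVinv,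
    perF_comp M hB' hK₂ hδB' hδ₂ hK₂inv, perF_comp M hK hV'd hδK hδV' hV'inv,
    perF_comp M hKW hK hδKW hδK hKinv, perF_comp M hK hWd hδK hδW hWinv,
    perF_K2OfK_dper M hM hKinv hK hδK hSt hS hδS hMt hMloc hδM ν y', perF_K2OfK_dper M hM hKinv hK hδK hSt hS hδS hMt hMloc hδM μ y, neg_one_smul]
  noncomm_ring

end K3

/-! ## §4 `e4OfKW` over the periodised tables on the coarse torus: the multiplier entry of the polynomial at the coarse points -/

section E4

variable {W : Fin (d + 1) → Site (d + 1) → Fin (d + 1) → Site (d + 1) → MKer (d + 1) (Fib d)} {CW δW : ℝ}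

/-- [folklore] **`perF_e4OfKW_dper_inl_inl` — THE TORUS READING OF THE PERIODISED SECOND BOND DERIVATIVE OF THE VALUE FUNCTION** (`M = N·M′`): with the letters of
`perF_K3OfK_dper`,
`perF M′ (e4OfKW N K S^per Mt^per W b b′) ((y₁, inl m₁), (y₂, inl m₂))
 = (Â·D̂_b·Â·D̂_{b′}·Â + Â·D̂_{b′}·Â·D̂_b·Â − Â·Ŵ·Â)((wrapPt M (N•y₁), inr m₁), (wrapPt M (N•y₂), inr m₂))`
— the `(inl, inl)`-placed coarse torus matrix of the `mm`-read IS the multiplier–multiplier entry of the fine torus polynomial at the coarse points (C2a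
`perF_mmRead_inl_inl_eq_perF` on the invariant `K3OfK^per`, then §3).  The order-2 twin of C2b `perF_e3OfK_inl_inl`. -/
theorem perF_e4OfKW_dper_inl_inl [∀ μ, NeZero (M' μ)] (hM : ∀ i, M i = N * M' i)
    (hKinv : ∀ (m x z : Site (d + 1)) (a b : Fib d), K (translate M x m) (translate M z m) a b = K x z a b)
    (hK : Decays K CK δK) (hδK : 0 < δK)
    (hSt : ∀ (κ : Fin (d + 1)) (u m x z : Site (d + 1)) (a b : Fib d), S κ (translate M u m) (translate M x m) (translate M z m) a b = S κ u x z a b)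
    (hS : ∀ κ u, BiLoc (S κ u) u u CS δS) (hδS : 0 < δS)
    (hMt : ∀ (ρ : Fin (d + 1)) (w m x z : Site (d + 1)) (a b : Fib d),
      Mt ρ (translate M' w m) (translate M x m) (translate M z m) a b = Mt ρ w x z a b)
    (hMloc : VertexFamily Mt N CM δM) (hδM : 0 < δM)
    (μ : Fin (d + 1)) (y : Site (d + 1)) (ν : Fin (d + 1)) (y' : Site (d + 1))
    (hWinv : ∀ (m x z : Site (d + 1)) (a b : Fib d), W μ y ν y' (translate M x m) (translate M z m) a b = W μ y ν y' x z a b)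
    (hWd : Decays (W μ y ν y') CW δW) (hδW : 0 < δW) (y₁ y₂ : ↥(pbox M')) (m₁ m₂ : Fin (d + 1)) :
    perF M' (e4OfKW N K (fun κ u => dper M (S κ u)) (fun ρ w => dper M (Mt ρ w)) W μ y ν y') (y₁, Sum.inl m₁) (y₂, Sum.inl m₂)
      = (perF M K * perF M (dM K N (fun κ u => dper M (S κ u)) (fun ρ w => dper M (Mt ρ w)) μ y) * perF M K
            * perF M (dM K N (fun κ u => dper M (S κ u)) (fun ρ w => dper M (Mt ρ w)) ν y') * perF M K
          + perF M K * perF M (dM K N (fun κ u => dper M (S κ u)) (fun ρ w => dper M (Mt ρ w)) ν y') * perF M K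
            * perF M (dM K N (fun κ u => dper M (S κ u)) (fun ρ w => dper M (Mt ρ w)) μ y) * perF M K
          - perF M K * perF M (W μ y ν y') * perF M K)
          (wrapPt M ((N : ℤ) • (y₁ : Site (d + 1))), Sum.inr m₁) (wrapPt M ((N : ℤ) • (y₂ : Site (d + 1))), Sum.inr m₂) := by
  have hXinv := K3OfK_dper_translate_inv M hM hKinv hK hδK hSt hS hδS hMt hMloc hδM μ y ν y' hWinv
  rw [← perF_K3OfK_dper M hM hKinv hK hδK hSt hS hδS hMt hMloc hδM μ y ν y' hWinv hWd hδW, ← perF_mmRead_inl_inl_eq_perF hM hXinv]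
  rfl

end E4

end Summit.QuantumFields.BalabanUV.Beta.CombHId2TorusWords

end
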